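import Summits.QuantumFields.YangMills.Theorems.BalabanUVNodesK0Stub1BHolds
import HarnessLib

/-!
# K0ᴬ V24 — STUB 1ᴮ CLOSED BY NAME AND SIGNATURE (the twin of ✓p778618 `…K0V23Stub1Closer` for the RE-CENTRED route item K0ᴬ stmt-QuantumFields-27238, skeleton V24 `K0Skeleton13SepCoPHV24`
# f6daae173f96d0a3 l.49): `∀ F : T4Family, K0V23Defs.Prop8StepCoPGridGBAt F` — the stub-1ᴮ text is UNCHANGED by the re-centring (centre-blind), so the landed supplier
# `K0Stub1BHolds.prop8StepCoPGridGBAt_holds_all` (✓p767981) closes it verbatim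

Cell `pub-ymgap`, YM-PLAN Track A (HUMAN RULING D-0062); seat `pub-ymgap-dag-n20-d` (g45) on dag-lead g41 WORDS 618 «(1ᴮ) HAND PASSES NOW» (director-ym №501 (1ᴮ) follow-up; D-0071).
`--kind proof --supports stmt-QuantumFields-27238` (K0ᴬ `StabilityBAtRecord13SepCoPHVAx`); count-neutral.  director-ym №370: the `dedup.landed` rule is waived in the stub-closer case only
(this file restates ✓p778618's statement token for token under a fresh namespace — that is the point: the V24 skeleton's stub table reads `stub_prop8StepCoPGridGB13` BY NAME + SIGNATURE on the
NEW item 27238, where ✓p778618 was keyed to K0⁷ 20541).  [15] = [Balaban1985Variational]; [II] = [Balaban1984PropagatorsII]; [III] = [Balaban1988Convergent].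

WHAT IS PROVED (sorry-free; no definition; axioms standard).  `stub_prop8StepCoPGridGB13 : ∀ F : T4Family, Prop8StepCoPGridGBAt F` — NAME + SIGNATURE EXACTLY AS REGISTERED on
stmt-QuantumFields-27238 (V24 skeleton l.49; `open …K0V23Defs (Prop8StepCoPGridGBAt)` as the skeleton does) — [15] Proposition 8's grid-guarded top step over print's [II] (2.3) datum
`lamDatum F` and print's (7) data for `N = 2`, for every four-torus family — by the landed supplier `K0Stub1BHolds.prop8StepCoPGridGBAt_holds_all` (S1c chain: dag-n05-e's record crown →
✓140 thm 1 → 125′ → 124′ → 123′ → 122′ → the F0c token).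
HONEST SCOPE (binding).  A by-name restatement; zero new content.  It CLOSES NOTHING by itself: the close of `stub_prop8StepCoPGridGB13` on 27238 is a ledger act on the registered V24
skeleton; K0ᴬ stays OPEN (stub 3ᴬ′ᴮ-Ax `stub_absBetaBoxAtThm1WitnessCCMGenGridGZBAx13` — the RE-CENTRED sign-free |β| box — and the composition remain); N07 NOT discharged; counts unmoved
(typed 28∕28 · discharged 8∕27); one finite 𝕋⁴ programme at fixed ε — nothing continuum ∕ ℝ⁴ ∕ OS; the Yang–Mills mass gap (Clay) is NOT proved by any of this.  No `def`, no `instance`,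
no `notation`, no `sorry`.

References: [15] Prop. 8 p. 304, (7) p. 278; [II] (2.3) p. 224; [III] (2.5) p. 255, (2.10) p. 256.
-/

set_option autoImplicit false

noncomputable section

namespace Summit.QuantumFields.YangMills.Theorems.K0V24Stub1Closer

open Literature.MathematicalPhysics.QuantumFieldTheory.Balaban1983to89
open Literature.MathematicalPhysics.QuantumFieldTheory.Balaban1983to89.T4Continuum
open Summit.QuantumFields.YangMills.Theorems.K0V23Defs (Prop8StepCoPGridGBAt)

/-- **`stub_prop8StepCoPGridGB13` — THE REGISTERED V24 STUB 1ᴮ OF K0ᴬ, BY NAME AND SIGNATURE**: `∀ F : T4Family, Prop8StepCoPGridGBAt F` — [15] Proposition 8's grid-guarded top step over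
print's [II] (2.3) datum and print's (7) data (`N = 2`), for every four-torus family (centre-blind: unchanged by the re-centring); proof = the landed supplier
`K0Stub1BHolds.prop8StepCoPGridGBAt_holds_all`. [cite: Balaban1985Variational, Prop. 8 p.304, (7) p.278; Balaban1984PropagatorsII, (2.3) p.224; Balaban1988Convergent, (2.5) p.255, (2.10) p.256] -/
theorem stub_prop8StepCoPGridGB13 : ∀ F : T4Family, Prop8StepCoPGridGBAt F :=
  Summit.QuantumFields.YangMills.BalabanUVNodes.K0Stub1BHolds.prop8StepCoPGridGBAt_holds_all

end Summit.QuantumFields.YangMills.Theorems.K0V24Stub1Closer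

end
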